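import Summits.QuantumFields.YangMills.Theorems.BalabanUVNodesN15KingModelExactCorrelationLength
import Literature.Analysis.Fourier.BeurlingFunction

/-!
# BalabanUVNodes ∕ N15 — THE KING-MODEL RUNG (PART Ϸ-p): THE ONE-DIMENSIONAL CLOSED FORM — in `d+1 = 1`, `S₂^{ℝ}(t) = (cosh m − 1)m⁻³·e^{−m|t|}` for integers `|t| ≥ 1`
# and `S₂^{ℝ}(0) = (m − 1 + e^{−m})∕m³` (Track A, DAG node N15 = NE2; FAN-OUT v1.1 §N15 s3 «KING-MODEL RUNG»; the `d = 0` instance of parts Ϸ-i∕j + the Fejér VALUE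
# `∫sinc²(x∕2)dx = 2π` from the tree's `Literature.Analysis.Fourier.integral_sinc_sq`; count-neutral)

HONEST FRAMING.  Count-neutral (cell `pub-ymgap`, seat `pub-ymgap-dag-n15-e` g34; `--supports stmt-QuantumFields-27366 --as helper` = K3⁸
`SpineGivenEndpointR13SepCoPHV`).  King's `A = 0`, `g = 0` model ([King1986] C. King, Commun. Math. Phys. **102** (1986) 649–677; `S₂^{ℝ}(z) =
(2π)^{−(d+1)}∫Π sinc²(p_μ∕2)cos(p·z)∕(p²+m²)dp`, (4.5) p.670, (4.36) p.674), specialised to ONE dimension (`d = 0`, `z = t ∈ ℤ`): the two-point function of the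
UNIT-INTERVAL AVERAGES of the one-dimensional free field (Ornstein–Uhlenbeck covariance `e^{−m|x|}∕(2m)`).  Part Ϸ-j's axis formula has an empty `p_⊥`-integral, so
`S₂^{ℝ}(t) = (2π)⁻¹·2π(cosh m − 1)m⁻³e^{−m|t|} = (cosh m − 1)m⁻³e^{−m|t|}` for `|t| ≥ 1`; at `t = 0` partial fractions, the Fejér VALUE `∫sinc²(x∕2)dx = 2π` (the tree's
`Literature.Analysis.Fourier.integral_sinc_sq`, `∫sinc²(πx)dx = 1`, rescaled) and the Lorentzian transform at `s = 0` give `S₂^{ℝ}(0) = m⁻²(1 − (1 − e^{−m})∕m)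
= (m − 1 + e^{−m})∕m³`.  (Both agree with the position-space averages `∫₀¹∫₀¹e^{−m|t+x−y|}∕(2m)dxdy` of the OU covariance — not formalised here.)  NOT a node discharge
(N15 is booked through n15-a's knit, untouched here); nothing Bałaban ∕ continuum-Yang–Mills ∕ `ℝ⁴` ∕ OS ∕ Clay.  0 `sorry`, 0 def; standard axioms.

WHAT THIS FILE PROVES (kernel).  §1 `integral_fin_zero_const`, ★★★ **`kingS2Inf_dim_one_eq`** (`|t| ≥ 1`).  §2 ★ `integral_sinc_sq_half` (`∫sinc²(x∕2)dx = 2π`),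
`integral_inv_sq_add_sq` (`∫dx∕(x²+M²) = π∕M`), `integral_one_sub_cos_div_sq_add_sq` (`∫2(1−cos x)∕(x²+M²)dx = 2π(1 − e^{−M})∕M`), ★★ `integral_sinc_sq_half_div`
(`∫sinc²(x∕2)∕(x²+M²)dx = 2π(M − 1 + e^{−M})∕M³`), `kingS2Inf_dim_one_zero_eq_integral`, ★★★ **`kingS2Inf_dim_one_zero`** (`S₂^{ℝ}(0) = (m − 1 + e^{−m})∕m³`).

HONEST SCOPE.  King's free model in `d+1 = 1` only (`K = ∞`, infinite volume).  N15 untouched; counts unmoved.  Locators (use): [King1986] (4.5) p.670, (4.36) p.674,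
Thm 3.3 (3.6) p.655; [ButzerNessel1971] (12.4.3) (Fejér), Problem 5.1.2 (Picard).
-/

noncomputable section

open scoped BigOperators Topology
open Filter MeasureTheory Set

namespace Summit.QuantumFields.YangMills.BalabanUVNodes.N15KingModelRung.OptimalDecay

/-! ## §1 `|t| ≥ 1`: the empty `p_⊥`-integral -/

/-- Over `ℝ^0` the integral of a constant is the constant. [folklore] -/
theorem integral_fin_zero_const (c : ℝ) : ∫ _q : Fin 0 → ℝ, c = c := by
  simp [integral_const, measureReal_def, MeasureTheory.volume_pi]

/-- ★★★ **THE ONE-DIMENSIONAL CLOSED FORM, `|t| ≥ 1`**: in `d+1 = 1`, `S₂^{ℝ}(t) = (cosh √m² − 1)∕√m²³·e^{−√m²|t|}` for every integer `|t| ≥ 1`.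
[cite: King1986, (4.5) p.670, (4.36) p.674, Thm 3.3 (3.6) p.655] -/
theorem kingS2Inf_dim_one_eq {m2 : ℝ} (hm : 0 < m2) {t : ℤ} (ht : 1 ≤ |(t : ℝ)|) :
    kingS2Inf m2 (Pi.single (0 : Fin 1) t) = (Real.cosh (Real.sqrt m2) - 1) / Real.sqrt m2 ^ 3 * Real.exp (-(Real.sqrt m2 * |(t : ℝ)|)) := by
  have h := kingS2Inf_single_eq (d := 0) hm 0 ht
  simp only [Finset.univ_eq_empty, Finset.prod_empty, Finset.sum_empty, zero_add, one_mul] at h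
  rw [h, integral_fin_zero_const]
  have hπ : (2 * Real.pi) ≠ 0 := by positivity
  simp only [pow_one]
  field_simp

/-! ## §2 `t = 0`: the Fejér value and the block variance -/

/-- ★ **The Fejér value**: `∫_ℝ sinc²(x∕2)dx = 2π` (the tree's `∫sinc²(πx)dx = 1`, `x = 2πu`). [cite: ButzerNessel1971, (12.4.3)] -/
theorem integral_sinc_sq_half : ∫ x : ℝ, Real.sinc (x / 2) ^ 2 = 2 * Real.pi := by
  have h := Literature.Analysis.Fourier.integral_sinc_sq
  have hscale := Measure.integral_comp_mul_left (fun x : ℝ => Real.sinc (x / 2) ^ 2) (2 * Real.pi)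
  have hpt : (fun x : ℝ => (fun x : ℝ => Real.sinc (x / 2) ^ 2) (2 * Real.pi * x)) = fun x => Real.sinc (Real.pi * x) ^ 2 := by
    funext x
    simp only
    congr 2
    ring
  rw [hpt, h] at hscale
  have hpi : 0 < 2 * Real.pi := by positivity
  rw [abs_of_pos (inv_pos.mpr hpi), smul_eq_mul] at hscale
  -- `1 = (2π)⁻¹ ∫ sinc²(x/2)`
  have := congrArg (fun r => 2 * Real.pi * r) hscale
  simp only [← mul_assoc, mul_inv_cancel₀ hpi.ne', one_mul, mul_one] at this
  exact this.symm

/-- `∫_ℝ dx∕(x²+M²) = π∕M` (`M > 0`; the Lorentzian transform at `s = 0`). [cite: ButzerNessel1971, Problem 5.1.2] -/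
theorem integral_inv_sq_add_sq {M : ℝ} (hM : 0 < M) : ∫ x : ℝ, 1 / (x ^ 2 + M ^ 2) = Real.pi / M := by
  have h := integral_cos_div_sq_add_sq hM 0
  simp only [mul_zero, Real.cos_zero, abs_zero, neg_zero, Real.exp_zero, mul_one] at h
  exact h

/-- `∫_ℝ 2(1 − cos x)∕(x²+M²)dx = 2π(1 − e^{−M})∕M` (`M > 0`). [cite: ButzerNessel1971, Problem 5.1.2] -/
theorem integral_one_sub_cos_div_sq_add_sq {M : ℝ} (hM : 0 < M) :
    ∫ x : ℝ, 2 * (1 - Real.cos x) / (x ^ 2 + M ^ 2) = 2 * Real.pi * (1 - Real.exp (-M)) / M := by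
  have h1 := integrable_cos_div_sq_add_sq hM 0
  have h2 := integrable_cos_div_sq_add_sq hM 1
  simp only [mul_zero, Real.cos_zero] at h1
  simp only [mul_one] at h2
  have hpt : (fun x : ℝ => 2 * (1 - Real.cos x) / (x ^ 2 + M ^ 2)) = fun x => 2 * (1 / (x ^ 2 + M ^ 2)) - 2 * (Real.cos x / (x ^ 2 + M ^ 2)) := by
    funext x
    ring
  have hc := integral_cos_div_sq_add_sq hM 1
  simp only [mul_one, abs_one] at hc
  rw [hpt, integral_sub (h1.const_mul 2) (h2.const_mul 2), integral_const_mul, integral_const_mul, integral_inv_sq_add_sq hM, hc]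
  ring

/-- ★★ `∫_ℝ sinc²(x∕2)∕(x²+M²)dx = 2π(M − 1 + e^{−M})∕M³` (`M > 0`; partial fractions + the Fejér value). [cite: ButzerNessel1971, (12.4.3), Problem 5.1.2] -/
theorem integral_sinc_sq_half_div {M : ℝ} (hM : 0 < M) :
    ∫ x : ℝ, Real.sinc (x / 2) ^ 2 / (x ^ 2 + M ^ 2) = 2 * Real.pi * (M - 1 + Real.exp (-M)) / M ^ 3 := by
  have hM0 : M ≠ 0 := hM.ne'
  have hpt : (fun x : ℝ => Real.sinc (x / 2) ^ 2 / (x ^ 2 + M ^ 2)) = fun x => (M ^ 2)⁻¹ * (Real.sinc (x / 2) ^ 2 - 2 * (1 - Real.cos x) / (x ^ 2 + M ^ 2)) := by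
    funext x
    exact sinc_sq_half_div_eq hM x
  have hA : Integrable fun x : ℝ => Real.sinc (x / 2) ^ 2 := by
    have h := integrable_sinc_sq_half_mul_cos 0
    simp only [mul_zero, Real.cos_zero, mul_one] at h
    exact h
  have hB : Integrable fun x : ℝ => 2 * (1 - Real.cos x) / (x ^ 2 + M ^ 2) := by
    have h1 := integrable_cos_div_sq_add_sq hM 0
    have h2 := integrable_cos_div_sq_add_sq hM 1
    simp only [mul_zero, Real.cos_zero] at h1
    simp only [mul_one] at h2
    have hpt' : (fun x : ℝ => 2 * (1 - Real.cos x) / (x ^ 2 + M ^ 2)) = fun x => 2 * (1 / (x ^ 2 + M ^ 2)) - 2 * (Real.cos x / (x ^ 2 + M ^ 2)) := by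
      funext x
      ring
    rw [hpt']
    exact (h1.const_mul 2).sub (h2.const_mul 2)
  rw [hpt, integral_const_mul, integral_sub hA hB, integral_sinc_sq_half, integral_one_sub_cos_div_sq_add_sq hM]
  field_simp
  ring

/-- In `d+1 = 1`, `S₂^{ℝ}(0) = (2π)⁻¹∫sinc²(x∕2)∕(x²+m²)dx` (the `ℝ^1`-integral as a line integral). [cite: King1986, (4.5) p.670] -/
theorem kingS2Inf_dim_one_zero_eq_integral (m2 : ℝ) :
    kingS2Inf m2 (0 : Fin 1 → ℤ) = (2 * Real.pi)⁻¹ * ∫ x : ℝ, Real.sinc (x / 2) ^ 2 / (x ^ 2 + m2) := by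
  unfold kingS2Inf
  have e1 : ((2 * Real.pi) ^ (0 + 1))⁻¹ = (2 * Real.pi)⁻¹ := by norm_num
  rw [e1]
  congr 1
  have hmp := volume_preserving_funUnique (Fin 1) ℝ
  rw [← hmp.integral_comp' (fun x : ℝ => Real.sinc (x / 2) ^ 2 / (x ^ 2 + m2))]
  refine integral_congr_ae (Eventually.of_forall fun p => ?_)
  rw [twoPtIntegrand_eq_prod]
  simp only [Fin.prod_univ_succ, Fin.prod_univ_zero, Fin.sum_univ_succ, Fin.sum_univ_zero, Pi.zero_apply, Int.cast_zero, mul_zero, Real.cos_zero, mul_one,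
    add_zero]
  rfl

/-- ★★★ **THE ONE-DIMENSIONAL BLOCK VARIANCE**: in `d+1 = 1`, `S₂^{ℝ}(0) = (√m² − 1 + e^{−√m²})∕√m²³` — the variance of the unit-interval average of the one-dimensional
free field of mass `m = √m²`. [cite: King1986, (4.5) p.670, (4.36) p.674] -/
theorem kingS2Inf_dim_one_zero {m2 : ℝ} (hm : 0 < m2) :
    kingS2Inf m2 (0 : Fin 1 → ℤ) = (Real.sqrt m2 - 1 + Real.exp (-Real.sqrt m2)) / Real.sqrt m2 ^ 3 := by
  have hm' : 0 < Real.sqrt m2 := Real.sqrt_pos.mpr hm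
  rw [kingS2Inf_dim_one_zero_eq_integral]
  have h := integral_sinc_sq_half_div hm'
  rw [Real.sq_sqrt hm.le] at h
  rw [h]
  have hπ : Real.pi ≠ 0 := Real.pi_pos.ne'
  field_simp

end Summit.QuantumFields.YangMills.BalabanUVNodes.N15KingModelRung.OptimalDecay
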